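import Summits.QuantumAdvantage.QuantumAdvantage.Theorems.CubicForrelationNearExactIsExactTwelveTypeO960Partner
import Summits.QuantumAdvantage.QuantumAdvantage.Theorems.CubicForrelationNearExactIsExactTwelveLevelSixEFlat
import Summits.QuantumAdvantage.QuantumAdvantage.Theorems.CubicForrelationNearExactIsExactFlatSumsGeneral

/-!
# Crux `CubicForrelation.NearExactIsExact` (stmt-QuantumAdvantage-14043) — n = 12 at `Φ = 932/1024`, type O with base set `960`: every LINEAR
  5-SPACE meets the base set `E` in a character sum `≡ 0 (mod 4)`

Certificate seat `b2b-cforr-cert` (gen 18).  HONEST FRAMING: a kernel-checked structure lemma (standard axioms) for the one open rung above the record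
at `n = 12` (`932/1024`); nothing is closed here, NO new value of `θ₁₂`.  NOT summit progress.

`to18_typeO_E960_flat5`: in a cubic pair with `g` type O, `#E = 960` and `Φ ≥ 932/1024`, the partner `f` is at level `≥ 6` with
`u_f'' − (−1)^g = s_b·(Ê(c₁ ⊕ y) − 1024·[y = c₁])/64` (`to18_typeO_E960_partner`); the 7-flat sums of this residual are `≡ 0 (mod 8)`
(`tw15_e_flat7`, which needs only that both functions are cubic), and a 7-flat sum of `Ê(c₁ ⊕ ·)` is `128` times a character sum of `E` over the
orthogonal space (`fs_sum_twist_flat`).  Result: for every `b` and every `a₀, …, a₆`,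
`Σ_{x ∈ E, x ⊥ a₀…a₆} (−1)^{x·(c₁ ⊕ b)} ≡ 0 (mod 4)`.  By translation covariance of the whole situation (`g ↦ g ⊕ ℓ_s`, `f ↦ f(· ⊕ s)`,
`E ↦ E ⊕ s` — paper, HOME/b2b-cforr-cert-g18/PLAN-N12-932.md) the same holds for affine 5-flats, in particular `#(E ∩ S) ≡ 0 (mod 4)` for every
affine 5-flat `S`; Kasami–Tokura's normal form `x₁·(x₂x₃ + x₄x₅ + x₆x₇ + x₈x₉)` of a weight-`960` cubic violates this (`span(e₁,…,e₅)` meets it in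
`6` points), so — modulo that classification step, which is NOT in the tree — no cubic pair attains `932/1024` through a type-O side of base `960`.

References: Kasami–Tokura (1970); MacWilliams–Sloane (1977) Ch. 13 §3, Ch. 15; Carlet (2021) §5.2.  Axioms: the standard three.
-/

set_option linter.dupNamespace false -- D-0017: single-problem summit ⇒ `QuantumAdvantage.QuantumAdvantage` by design

noncomputable section

namespace Summit.QuantumAdvantage.QuantumAdvantage.Theorems.CubicForrelation.NearExactIsExact

open Finset
open Literature.Computability.QuantumComplexity
open Literature.Computability.QuantumComplexity.BuzetChailloux (bxor zeroVec bxor_bxor_cancel_left bxor_zeroVec zeroVec_bxor bxor_comm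
  bxor_self twist_zeroVec_right twist_bxor_right)
open Literature.Computability.QuantumComplexity.DerivativeWalsh (W)
open Literature.Computability.QuantumComplexity.Simon (twist_eq_one_or)
open Summit.QuantumAdvantage.QuantumAdvantage.Theorems.NearExactIsExact.Negative (TypeOTwelve.typeO_of_exists_odd)

/-- **Type O with `#E = 960` at `Φ ≥ 932/1024`: character sums of `E` over every linear space cut out by seven vectors are `≡ 0 (mod 4)`.**
See the module docstring.  NOT summit progress. [this work] -/
theorem to18_typeO_E960_flat5 (f g : (Fin (6 + 6) → Bool) → Bool) (hf : IsDegLeFun 3 f) (hg : IsDegLeFun 3 g)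
    (u : (Fin (6 + 6) → Bool) → ℤ) (hu : ∀ x, W (fun y => signOf (g y)) x = (2 : ℝ) ^ 4 * (u x : ℝ))
    (hodd : ∃ x, Odd (u x)) (hE : #(univ.filter fun x : Fin (6 + 6) → Bool => (Odd (u x / 2) ↔ Odd (u x / 2 / 2))) = 960)
    (hΦ : (932 / 1024 : ℝ) ≤ forrelation f g) :
    ∃ c₁ : Fin (6 + 6) → Bool, ∀ (b : Fin (6 + 6) → Bool) (a : Fin 7 → Fin (6 + 6) → Bool), ∃ m : ℤ,
      ∑ x ∈ (univ.filter fun x : Fin (6 + 6) → Bool => (Odd (u x / 2) ↔ Odd (u x / 2 / 2))).filter (fun x => ∀ i, twist (a i) x = 1),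
        twist x (bxor c₁ b) = 4 * (m : ℝ) := by
  classical
  obtain ⟨uf, huf⟩ := tw_base (n := 6 + 6) f hf 4 (by norm_num)
  obtain ⟨c₁, b₁, hcb, hid, h4⟩ := to18_typeO_E960_partner f g hg u hu hodd hE hΦ uf huf
  set E := univ.filter (fun x : Fin (6 + 6) → Bool => (Odd (u x / 2) ↔ Odd (u x / 2 / 2))) with hEdef
  refine ⟨c₁, fun b a => ?_⟩
  -- `f` at level `6`: `W_f = 64·k` with `k = u_f/4`
  set k : (Fin (6 + 6) → Bool) → ℤ := fun y => uf y / 4 with hkdef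
  have hk4 : ∀ y, uf y = 4 * k y := fun y => by
    obtain ⟨q, hq⟩ := h4 y
    simp only [k]; rw [hq, Int.mul_ediv_cancel_left _ (by norm_num : (4 : ℤ) ≠ 0)]
  have hwf : ∀ y, W (fun x => signOf (f x)) y = (2 : ℝ) ^ 6 * (k y : ℝ) := by
    intro y; rw [huf y, hk4 y]; push_cast; ring
  -- the residual `k − (−1)^g` in closed form
  have hres : ∀ y, ((k y : ℝ) - signOf (g y)) * 64 =
      signOf b₁ * (∑ x ∈ E, twist x (bxor c₁ y)) - signOf b₁ * 16 * (if bxor c₁ y = (fun _ => false) then (64 : ℝ) else 0) := by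
    intro y
    have h := hid y
    have hk : (uf y : ℝ) = 4 * (k y : ℝ) := by exact_mod_cast hk4 y
    rw [hk] at h
    split_ifs at h with hz
    · rw [if_pos hz]; norm_num at h ⊢; linarith
    · rw [if_neg hz]; linarith
  -- the 7-flat sum of the residual is `≡ 0 (mod 8)`
  have h8 := tw15_e_flat7 g f hg hf k hwf b a
  set pt : (Fin 7 → Bool) → (Fin (6 + 6) → Bool) := fun ε => fun j => b j ^^ decide (Odd #(univ.filter fun i => ε i && a i j)) with hpt
  obtain ⟨M, hM⟩ := h8
  change ∑ ε : Fin 7 → Bool, (k (pt ε) - sZ (g (pt ε))) = 8 * M at hM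
  -- the same sum in closed form: `64·Σ = s_b (Σ_ε Ê(c₁ ⊕ pt ε) − 1024·N)`
  have hflat : ∑ ε : Fin 7 → Bool, ∑ x ∈ E, twist x (bxor c₁ (pt ε)) =
      128 * ∑ x ∈ E.filter (fun x => ∀ i, twist (a i) x = 1), twist x (bxor c₁ b) := by
    rw [sum_comm]
    have inner : ∀ x, ∑ ε : Fin 7 → Bool, twist x (bxor c₁ (pt ε)) =
        twist x c₁ * (if (∀ i, twist (a i) x = 1) then 2 ^ 7 * twist b x else 0) := by
      intro x
      rw [← fs_sum_twist_flat b a x, mul_sum]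
      refine sum_congr rfl fun ε _ => ?_
      rw [twist_bxor_right, twist_comm (pt ε) x]
    rw [sum_congr rfl fun x _ => inner x, ← sum_filter_add_sum_filter_not E (fun x => ∀ i, twist (a i) x = 1)]
    have e0 : ∑ x ∈ E.filter (fun x => ¬ ∀ i, twist (a i) x = 1),
        twist x c₁ * (if (∀ i, twist (a i) x = 1) then (2 : ℝ) ^ 7 * twist b x else 0) = 0 :=
      sum_eq_zero fun x hx => by rw [if_neg (mem_filter.1 hx).2, mul_zero]
    rw [e0, add_zero, mul_sum]
    refine sum_congr rfl fun x hx => ?_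
    rw [if_pos (mem_filter.1 hx).2, twist_bxor_right, twist_comm b x]
    ring
  -- combine
  set T := ∑ x ∈ E.filter (fun x => ∀ i, twist (a i) x = 1), twist x (bxor c₁ b) with hT
  set N := #((univ : Finset (Fin 7 → Bool)).filter fun ε => bxor c₁ (pt ε) = (fun _ => false)) with hN
  have hcnt : (∑ ε : Fin 7 → Bool, (if bxor c₁ (pt ε) = (fun _ => false) then (64 : ℝ) else 0)) = 64 * (N : ℝ) := by
    rw [show (∑ ε : Fin 7 → Bool, (if bxor c₁ (pt ε) = (fun _ => false) then (64 : ℝ) else 0)) =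
        ∑ ε : Fin 7 → Bool, 64 * (if bxor c₁ (pt ε) = (fun _ => false) then (1 : ℝ) else 0) from
      sum_congr rfl fun ε _ => by split_ifs <;> simp, ← mul_sum, sum_boole]
  have hsum64 : ((8 * M : ℤ) : ℝ) * 64 = signOf b₁ * (128 * T) - signOf b₁ * 16 * (64 * (N : ℝ)) := by
    have e1 : ((8 * M : ℤ) : ℝ) = ∑ ε : Fin 7 → Bool, ((k (pt ε) : ℝ) - signOf (g (pt ε))) := by
      rw [← hM]; push_cast
      refine sum_congr rfl fun ε _ => ?_
      rw [tp_sZ_cast]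
    have e2 : (∑ ε : Fin 7 → Bool, ((k (pt ε) : ℝ) - signOf (g (pt ε)))) * 64 =
        ∑ ε : Fin 7 → Bool, (signOf b₁ * (∑ x ∈ E, twist x (bxor c₁ (pt ε))) -
          signOf b₁ * 16 * (if bxor c₁ (pt ε) = (fun _ => false) then (64 : ℝ) else 0)) := by
      rw [sum_mul]
      exact sum_congr rfl fun ε _ => hres (pt ε)
    rw [e1, e2, sum_sub_distrib, ← mul_sum, hflat, ← hcnt]
    congr 1
    rw [← mul_sum]
  -- `T` is an integer: the sum of `±1`
  set TZ : ℤ := ∑ x ∈ E.filter (fun x => ∀ i, twist (a i) x = 1),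
    sZ (decide (Odd #(univ.filter fun i => (x i && (bxor c₁ b) i) = true))) with hTZ
  have hTT : T = (TZ : ℝ) := by
    simp only [T, TZ]; push_cast
    refine sum_congr rfl fun x _ => ?_
    rw [tp_sZ_cast, vg_twist_eq_signOf]
  rw [hTT] at hsum64
  have hsb : signOf b₁ = 1 ∨ signOf b₁ = -1 := by cases b₁ <;> simp [signOf]
  refine ⟨sZ b₁ * M + 2 * (N : ℤ), ?_⟩
  rw [hTT]
  have key : (TZ : ℝ) = 4 * ((sZ b₁ : ℝ) * (M : ℝ) + 2 * (N : ℝ)) := by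
    rw [tp_sZ_cast]
    push_cast at hsum64
    rcases hsb with h | h <;> rw [h] at hsum64 ⊢ <;> linarith
  rw [key]; push_cast; ring

end Summit.QuantumAdvantage.QuantumAdvantage.Theorems.CubicForrelation.NearExactIsExact

end
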